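import Summits.AtomisticToContinuum.Crystallization.Theses.ExcessDecayLiouville

/-!
# `HcpLiouville` / Negative: the force-balance hypothesis is load-bearing

Negative knowledge for crux `stmt-AtomisticToContinuum-9332`
(`ExcessDecayLiouville.HcpLiouville`, route `ExcessDecayLiouville`, rank 3), crux-disprover seat
(2026-08-16); companion of `LoadBearing.lean` (matching and admissibility).

`HcpLiouville` is definitionally `PhononStability → Core`; `Core` says that a `δ`-separated Lennard-Jones
force-balanced `X ⊂ ℝ³`, globally two-way `1/40`-matched with an admissible affine hcp two-lattice datum
`(t, A)`, is exactly a two-lattice `{t'_m + A' z : z ∈ Λ}` with `A'` admissible. Here we certify that the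
force balance `Equil X` cannot be dropped:

* `hcpLiouvilleCore_false_without_equil` — `X = hcpStacking 0.97 (0.97·√(2/3)) ∪ {(0, 0, 1/40)}` (the
  exact reference hcp two-lattice plus ONE extra particle at distance `1/40` from the site `0`) is
  `1/40`-separated and globally two-way `1/40`-matched with the exact datum (`A = 0.97·id`,
  `t = (0, 0.97(w + √(2/3)e₃))`), but it is not `{t'_m + A' z}` for any admissible `A'`: if `0` and the
  extra particle `p₀` lay in one coset, `p₀ ∈ A'(Λ ∖ 0)` would have norm `≥ 0.945`
  (`hcpLiouvilleAdm_norm_le`, `hcpLiouvilleLam_one_le_norm`); if in different cosets, `X` would be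
  invariant under the translation `± p₀` on a coset and contain `q₁ ± p₀` for the site `q₁ = (0.97, 0, 0)`,
  whose height `± 1/40` is not a layer height. Physically the pair `0, p₀` repels with force `≈ 40¹³`:
  force balance is exactly what removes such configurations.

Infrastructure proved on the way (plain lemmas, reusable by provers of the crux): coordinates and the norm
form `i² + ij + j² + (8/3)k²` of the period lattice `Λ = ℤu + ℤv + ℤ·2√(2/3)e₃` (`hcpLiouvilleLam_apply`,
`hcpLiouvilleLam_norm_sq`), its uniform discreteness (`hcpLiouvilleLam_one_le_norm`), closure under `±`,
the uniform injectivity `‖A v‖ ≥ 0.945‖v‖` of admissible cells (`hcpLiouvilleAdm_norm_le`), and the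
identification of the crux's site set for `A = a·id`, `t = (0, a(w + √(2/3)e₃))` with the library's
`hcpStacking a (a√(2/3))` (`hcpLiouvilleSites_eq_hcpStacking`). The statement refuted is the crux's own
`let`-text with `Equil X →` (and the `PhononStability` antecedent) deleted. Nothing here closes an item.
-/

noncomputable section

namespace Summit.AtomisticToContinuum.Crystallization.Theorems

open Literature.MathematicalPhysics.StatisticalMechanics

local notation "E3" => EuclideanSpace ℝ (Fin 3)

-- The period lattice `Λ` of the unit hcp two-lattice, exactly as spelled in the crux (a notation, not a
-- definition, so that every statement below is literally about the crux's own set).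
set_option quotPrecheck false in
local notation "Λₕ" => ({z : EuclideanSpace ℝ (Fin 3) | ∃ i j k : ℤ, z = (i : ℝ) • triangularVec₁ 1 +
    (j : ℝ) • triangularVec₂ 1 + (k : ℝ) • layerNormal (2 * Real.sqrt (2 / 3))} : Set (EuclideanSpace ℝ (Fin 3)))

/-- Coordinates of `i u + j v + k c`. [folklore] -/
theorem hcpLiouvilleLam_apply (i j k : ℤ) :
    let z : E3 := (i : ℝ) • triangularVec₁ 1 + (j : ℝ) • triangularVec₂ 1 +
      (k : ℝ) • layerNormal (2 * Real.sqrt (2 / 3))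
    z 0 = i + j * 2⁻¹ ∧ z 1 = j * (√3 / 2) ∧ z 2 = k * (2 * Real.sqrt (2 / 3)) := by
  refine ⟨?_, ?_, ?_⟩ <;> simp [triangularVec₁, triangularVec₂, layerNormal]

/-- `|i u + j v + k c|² = i² + ij + j² + (8/3) k²`. [folklore] -/
theorem hcpLiouvilleLam_norm_sq (i j k : ℤ) :
    ‖(i : ℝ) • triangularVec₁ 1 + (j : ℝ) • triangularVec₂ 1 +
      (k : ℝ) • (layerNormal (2 * Real.sqrt (2 / 3)) : E3)‖ ^ 2
      = ((i : ℝ) ^ 2 + i * j + j ^ 2) + 8 / 3 * (k : ℝ) ^ 2 := by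
  obtain ⟨h0, h1, h2⟩ := hcpLiouvilleLam_apply i j k
  rw [EuclideanSpace.norm_sq_eq, Fin.sum_univ_three]
  simp only [Real.norm_eq_abs, sq_abs]
  rw [h0, h1, h2]
  have h3 : (√3 : ℝ) ^ 2 = 3 := Real.sq_sqrt (by norm_num)
  have h23 : (Real.sqrt (2 / 3)) ^ 2 = 2 / 3 := Real.sq_sqrt (by norm_num)
  linear_combination ((j : ℝ) ^ 2 / 4) * h3 + (4 * (k : ℝ) ^ 2) * h23

/-- **`Λ` is uniformly discrete**: its nonzero vectors have norm `≥ 1`. [folklore] -/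
theorem hcpLiouvilleLam_one_le_norm {z : E3} (hz : z ∈ Λₕ) (h0 : z ≠ 0) : 1 ≤ ‖z‖ := by
  obtain ⟨i, j, k, rfl⟩ := hz
  have hsq := hcpLiouvilleLam_norm_sq i j k
  have h1 : (1 : ℝ) ≤ ((i : ℝ) ^ 2 + i * j + j ^ 2) + 8 / 3 * (k : ℝ) ^ 2 := by
    by_cases hk : k = 0
    · subst hk
      have hij : (i, j) ≠ 0 := by
        rintro hij
        simp only [Prod.mk_eq_zero] at hij
        obtain ⟨rfl, rfl⟩ := hij
        exact h0 (by simp)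
      have := one_le_sq_add_mul_add_sq hij
      have : (1 : ℝ) ≤ (i : ℝ) ^ 2 + i * j + j ^ 2 := by exact_mod_cast this
      simp; linarith
    · have hk1 : (1 : ℝ) ≤ (k : ℝ) ^ 2 := by
        have : 1 ≤ k ^ 2 := by nlinarith [Int.one_le_abs hk, sq_abs k]
        exact_mod_cast this
      nlinarith [sq_nonneg ((i : ℝ) + j / 2), sq_nonneg (j : ℝ)]
  have : (1 : ℝ) ≤ ‖_‖ ^ 2 := hsq ▸ h1
  nlinarith [norm_nonneg ((i : ℝ) • triangularVec₁ 1 + (j : ℝ) • triangularVec₂ 1 +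
      (k : ℝ) • (layerNormal (2 * Real.sqrt (2 / 3)) : E3))]

/-- `Λ` is closed under subtraction. [folklore] -/
theorem hcpLiouvilleLam_sub_mem {x y : E3} (hx : x ∈ Λₕ) (hy : y ∈ Λₕ) : x - y ∈ Λₕ := by
  obtain ⟨i, j, k, rfl⟩ := hx
  obtain ⟨i', j', k', rfl⟩ := hy
  refine ⟨i - i', j - j', k - k', ?_⟩
  push_cast
  module

/-- `Λ` is closed under addition. [folklore] -/
theorem hcpLiouvilleLam_add_mem {x y : E3} (hx : x ∈ Λₕ) (hy : y ∈ Λₕ) : x + y ∈ Λₕ := by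
  obtain ⟨i, j, k, rfl⟩ := hx
  obtain ⟨i', j', k', rfl⟩ := hy
  refine ⟨i + i', j + j', k + k', ?_⟩
  push_cast
  module

/-- **Admissible cells are uniformly injective**: `‖A − 0.97 R‖ ≤ 1/40` gives `‖A v‖ ≥ 0.945 ‖v‖`.
[folklore] -/
theorem hcpLiouvilleAdm_norm_le {A : E3 →L[ℝ] E3}
    (hA : ∃ R : E3 ≃ₗᵢ[ℝ] E3, ‖A - (97 / 100 : ℝ) • (R.toContinuousLinearEquiv : E3 →L[ℝ] E3)‖ ≤ 1 / 40)
    (v : E3) : (189 / 200) * ‖v‖ ≤ ‖A v‖ := by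
  obtain ⟨R, hR⟩ := hA
  have h1 : ‖(A - (97 / 100 : ℝ) • (R.toContinuousLinearEquiv : E3 →L[ℝ] E3)) v‖ ≤ 1 / 40 * ‖v‖ :=
    (ContinuousLinearMap.le_opNorm _ _).trans (mul_le_mul_of_nonneg_right hR (norm_nonneg _))
  have h2 : ‖((97 / 100 : ℝ) • (R.toContinuousLinearEquiv : E3 →L[ℝ] E3)) v‖ = 97 / 100 * ‖v‖ := by
    simp [norm_smul]
  have h3 := norm_sub_norm_le (((97 / 100 : ℝ) • (R.toContinuousLinearEquiv : E3 →L[ℝ] E3)) v) (A v)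
  rw [h2, norm_sub_rev] at h3
  have h4 : ‖A v - ((97 / 100 : ℝ) • (R.toContinuousLinearEquiv : E3 →L[ℝ] E3)) v‖ =
      ‖(A - (97 / 100 : ℝ) • (R.toContinuousLinearEquiv : E3 →L[ℝ] E3)) v‖ := by
    simp only [sub_apply]
  linarith [h4 ▸ h3]

/-- **The crux's site set for the isotropic cell `a · id` and the exact hcp translations
`t = (0, a(w + √(2/3)e₃))` is the library's `hcpStacking a (a√(2/3))`.** [cite: HalesDSP2012, §1.3] -/
theorem hcpLiouvilleSites_eq_hcpStacking (a : ℝ) :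
    {p : E3 | ∃ m : Fin 2, ∃ z ∈ Λₕ,
      p = (![0, a • (barlowOffset 1 + layerNormal (Real.sqrt (2 / 3)))] : Fin 2 → E3) m +
        (a • ContinuousLinearMap.id ℝ E3) z}
      = hcpStacking a (a * Real.sqrt (2 / 3)) := by
  ext p
  constructor
  · rintro ⟨m, z, ⟨i, j, k, rfl⟩, rfl⟩
    fin_cases m
    · refine ⟨2 * k, i, j, ?_⟩
      have hE : haggLabel alternatingHagg (2 * k) = 0 := by
        rw [haggLabel_alternating, if_pos (even_two_mul k)]
      ext l; fin_cases l <;>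
        simp [barlowPos, triangularVec₁, triangularVec₂, barlowOffset, layerNormal, hE] <;> ring
    · refine ⟨2 * k + 1, i, j, ?_⟩
      have hO : haggLabel alternatingHagg (2 * k + 1) = 1 := by
        rw [haggLabel_alternating, if_neg (Int.not_even_two_mul_add_one k)]
      ext l; fin_cases l <;>
        simp [barlowPos, triangularVec₁, triangularVec₂, barlowOffset, layerNormal, hO] <;> ring
  · rintro ⟨K, i, j, rfl⟩
    rcases Int.even_or_odd' K with ⟨k, rfl | rfl⟩
    · refine ⟨0, _, ⟨i, j, k, rfl⟩, ?_⟩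
      have hE : haggLabel alternatingHagg (2 * k) = 0 := by
        rw [haggLabel_alternating, if_pos (even_two_mul k)]
      ext l; fin_cases l <;>
        simp [barlowPos, triangularVec₁, triangularVec₂, barlowOffset, layerNormal, hE] <;> ring
    · refine ⟨1, _, ⟨i, j, k, rfl⟩, ?_⟩
      have hO : haggLabel alternatingHagg (2 * k + 1) = 1 := by
        rw [haggLabel_alternating, if_neg (Int.not_even_two_mul_add_one k)]
      ext l; fin_cases l <;>
        simp [barlowPos, triangularVec₁, triangularVec₂, barlowOffset, layerNormal, hO] <;> ring

/-- **The force-balance hypothesis `Equil X` of `HcpLiouville` is load-bearing**: the crux's `Core` with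
`Equil X →` deleted is false. Witness: `δ = 1/40`, `X = hcpStacking 0.97 (0.97√(2/3)) ∪ {(0,0,1/40)}`, datum
`A = 0.97·id`, `t = (0, 0.97(w + √(2/3)e₃))`; see the module docstring for the argument. [folklore] -/
theorem hcpLiouvilleCore_false_without_equil :
    ¬ (let Λ : Set (EuclideanSpace ℝ (Fin 3)) := {z | ∃ i j k : ℤ, z = (i : ℝ) • triangularVec₁ 1 +
          (j : ℝ) • triangularVec₂ 1 + (k : ℝ) • layerNormal (2 * Real.sqrt (2 / 3))}
       let Near : Set (EuclideanSpace ℝ (Fin 3)) → EuclideanSpace ℝ (Fin 3) → ℝ →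
          (Fin 2 → EuclideanSpace ℝ (Fin 3)) →
          (EuclideanSpace ℝ (Fin 3) →L[ℝ] EuclideanSpace ℝ (Fin 3)) → ℝ → Prop :=
          fun X c r t A ε => (∀ p ∈ X, dist p c ≤ r → ∃ m : Fin 2, ∃ z ∈ Λ, dist p (t m + A z) ≤ ε) ∧
            (∀ m : Fin 2, ∀ z ∈ Λ, dist (t m + A z) c ≤ r → ∃ p ∈ X, dist p (t m + A z) ≤ ε)
       let Adm : (EuclideanSpace ℝ (Fin 3) →L[ℝ] EuclideanSpace ℝ (Fin 3)) → Prop := fun A =>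
          ∃ R : EuclideanSpace ℝ (Fin 3) ≃ₗᵢ[ℝ] EuclideanSpace ℝ (Fin 3),
            ‖A - (97 / 100 : ℝ) • (R.toContinuousLinearEquiv :
              EuclideanSpace ℝ (Fin 3) →L[ℝ] EuclideanSpace ℝ (Fin 3))‖ ≤ 1 / 40
       let Inner : (Fin 2 → EuclideanSpace ℝ (Fin 3)) →
          (EuclideanSpace ℝ (Fin 3) →L[ℝ] EuclideanSpace ℝ (Fin 3)) → Prop := fun t A =>
          ‖t 1 - t 0 - A (barlowOffset 1 + layerNormal (Real.sqrt (2 / 3)))‖ ≤ 1 / 40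
       let Sites : (Fin 2 → EuclideanSpace ℝ (Fin 3)) →
          (EuclideanSpace ℝ (Fin 3) →L[ℝ] EuclideanSpace ℝ (Fin 3)) → Set (EuclideanSpace ℝ (Fin 3)) :=
          fun t A => {p | ∃ m : Fin 2, ∃ z ∈ Λ, p = t m + A z}
       let Sep : Set (EuclideanSpace ℝ (Fin 3)) → ℝ → Prop := fun X δ =>
          ∀ p ∈ X, ∀ q ∈ X, p ≠ q → δ ≤ dist p q
       ∀ δ : ℝ, 0 < δ → ∀ X : Set (EuclideanSpace ℝ (Fin 3)), Sep X δ →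
         ∀ (t : Fin 2 → EuclideanSpace ℝ (Fin 3))
           (A : EuclideanSpace ℝ (Fin 3) →L[ℝ] EuclideanSpace ℝ (Fin 3)), Adm A → Inner t A →
           (∀ (c : EuclideanSpace ℝ (Fin 3)) (r : ℝ), Near X c r t A (1 / 40)) →
           ∃ (t' : Fin 2 → EuclideanSpace ℝ (Fin 3))
             (A' : EuclideanSpace ℝ (Fin 3) →L[ℝ] EuclideanSpace ℝ (Fin 3)), Adm A' ∧ X = Sites t' A') := by
  intro h
  -- the reference datum: isotropic cell 0.97, exact hcp translations
  set a : ℝ := 97 / 100 with ha_def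
  have ha0 : (0 : ℝ) ≤ a := by norm_num [ha_def]
  set hh : ℝ := a * Real.sqrt (2 / 3) with hh_def
  have hs : (1 / 2 : ℝ) < Real.sqrt (2 / 3) := by
    rw [show (1 / 2 : ℝ) = Real.sqrt (1 / 4) by
      rw [show (1 / 4 : ℝ) = (1 / 2) ^ 2 by norm_num, Real.sqrt_sq (by norm_num)]]
    exact Real.sqrt_lt_sqrt (by norm_num) (by norm_num)
  have hh1 : (1 / 20 : ℝ) < hh := by rw [hh_def, ha_def]; nlinarith
  have hh0 : (0 : ℝ) ≤ hh := by linarith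
  let A : E3 →L[ℝ] E3 := a • ContinuousLinearMap.id ℝ E3
  let t : Fin 2 → E3 := ![0, a • (barlowOffset 1 + layerNormal (Real.sqrt (2 / 3)))]
  have hSites : {p : E3 | ∃ m : Fin 2, ∃ z ∈ Λₕ, p = t m + A z} = hcpStacking a hh :=
    hcpLiouvilleSites_eq_hcpStacking a
  have hAdm : ∃ R : E3 ≃ₗᵢ[ℝ] E3, ‖A - (97 / 100 : ℝ) • (R.toContinuousLinearEquiv : E3 →L[ℝ] E3)‖ ≤ 1 / 40 := by
    refine ⟨LinearIsometryEquiv.refl ℝ E3, ?_⟩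
    have h0 : A - (97 / 100 : ℝ) •
        ((LinearIsometryEquiv.refl ℝ E3).toContinuousLinearEquiv : E3 →L[ℝ] E3) = 0 := by
      apply ContinuousLinearMap.ext
      intro x
      simp [A, ha_def]
    rw [h0, norm_zero]
    norm_num
  have hInner : ‖t 1 - t 0 - A (barlowOffset 1 + layerNormal (Real.sqrt (2 / 3)))‖ ≤ 1 / 40 := by
    simp only [t, A, Matrix.cons_val_one, Matrix.cons_val_zero, Matrix.cons_val_fin_one,
      sub_zero, FunLike.coe_smul, Pi.smul_apply, ContinuousLinearMap.id_apply, sub_self,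
      norm_zero]
    norm_num
  -- the extra particle and the configuration
  let p₀ : E3 := layerNormal (1 / 40)
  have hp₀ : ‖p₀‖ = 1 / 40 := by
    rw [EuclideanSpace.norm_eq, Fin.sum_univ_three]
    simp [p₀, layerNormal]
  let X : Set E3 := hcpStacking a hh ∪ {p₀}
  have h0hcp : (0 : E3) ∈ hcpStacking a hh := by
    have : barlowPos a hh alternatingHagg 0 0 0 = 0 := by
      ext l; fin_cases l <;> simp
    exact this ▸ barlowPos_mem 0 0 0
  -- hypotheses of `Core` for the witness
  have hSep : ∀ p ∈ X, ∀ q ∈ X, p ≠ q → (1 / 40 : ℝ) ≤ dist p q := by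
    have key : ∀ q ∈ hcpStacking a hh, 1 / 40 ≤ dist q p₀ := by
      intro q hq
      by_cases hq0 : q = 0
      · subst hq0; rw [dist_comm, dist_zero_right, hp₀]
      · have h1 : min a hh ≤ dist q 0 :=
          le_dist_of_mem_barlowStacking a hh alternatingHagg ha0 hh0 hq h0hcp hq0
        have h2 : dist q 0 ≤ dist q p₀ + dist p₀ 0 := dist_triangle _ _ _
        rw [dist_zero_right p₀, hp₀] at h2
        have h3 : (1 / 20 : ℝ) ≤ min a hh := le_min (by norm_num [ha_def]) hh1.le
        linarith
    rintro p (hp | hp) q (hq | hq) hne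
    · have h3 : (1 / 20 : ℝ) ≤ min a hh := le_min (by norm_num [ha_def]) hh1.le
      exact le_trans (by linarith) (le_dist_of_mem_barlowStacking a hh alternatingHagg ha0 hh0 hp hq hne)
    · rw [Set.mem_singleton_iff] at hq; subst hq; exact key p hp
    · rw [Set.mem_singleton_iff] at hp; subst hp; rw [dist_comm]; exact key q hq
    · rw [Set.mem_singleton_iff] at hp hq; exact (hne (hp.trans hq.symm)).elim
  have hNear : ∀ (c : E3) (r : ℝ),
      (∀ p ∈ X, dist p c ≤ r → ∃ m : Fin 2, ∃ z ∈ Λₕ, dist p (t m + A z) ≤ 1 / 40) ∧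
      (∀ m : Fin 2, ∀ z ∈ Λₕ, dist (t m + A z) c ≤ r → ∃ p ∈ X, dist p (t m + A z) ≤ 1 / 40) := by
    intro c r
    constructor
    · rintro p (hp | hp) -
      · rw [← hSites] at hp
        obtain ⟨m, z, hz, rfl⟩ := hp
        exact ⟨m, z, hz, by simp⟩
      · rw [Set.mem_singleton_iff] at hp
        subst hp
        refine ⟨0, 0, ⟨0, 0, 0, by simp⟩, ?_⟩
        simp [t, dist_eq_norm, hp₀]
    · intro m z hz _
      refine ⟨t m + A z, ?_, by simp⟩
      left
      rw [← hSites]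
      exact ⟨m, z, hz, rfl⟩
  obtain ⟨t', A', hA', hX⟩ := h (1 / 40) (by norm_num) X hSep t A hAdm hInner hNear
  clear h hNear hSep hAdm hInner
  have hlow := hcpLiouvilleAdm_norm_le hA'
  -- three particles of X as points of the concluded two-lattice
  set q₁ : E3 := barlowPos a hh alternatingHagg 0 1 0 with hq₁_def
  have hq₁0 : q₁ 0 = a := by rw [hq₁_def, barlowPos_apply_zero]; simp
  have hq₁2 : q₁ 2 = 0 := by rw [hq₁_def, barlowPos_apply_two]; simp
  have h0X : (0 : E3) ∈ X := Or.inl h0hcp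
  have hpX : p₀ ∈ X := Or.inr rfl
  have hqX : q₁ ∈ X := Or.inl (barlowPos_mem 0 1 0)
  rw [hX] at h0X hpX hqX
  obtain ⟨m₀, z₀, hz₀, e₀⟩ := h0X
  obtain ⟨m₁, z₁, hz₁, e₁⟩ := hpX
  obtain ⟨m₂, z₂, hz₂, e₂⟩ := hqX
  -- no point of X has first coordinate `a` and third coordinate `±1/40`
  have notin : ∀ s : ℝ, (s = 1 ∨ s = -1) → q₁ + s • p₀ ∉ X := by
    rintro s hs (hmem | hmem)
    · obtain ⟨K, i, j, hK⟩ := hmem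
      have e2 := congrArg (fun v : E3 => v 2) hK
      simp only [PiLp.add_apply, PiLp.smul_apply, hq₁2, barlowPos_apply_two, smul_eq_mul] at e2
      have hp2 : p₀ 2 = 1 / 40 := by simp [p₀, layerNormal]
      rw [hp2] at e2
      rcases lt_trichotomy K 0 with hK0 | rfl | hK0
      · have : (K : ℝ) ≤ -1 := by exact_mod_cast Int.le_sub_one_iff.mpr hK0
        rcases hs with rfl | rfl <;> nlinarith
      · rcases hs with rfl | rfl <;> norm_num at e2
      · have : (1 : ℝ) ≤ K := by exact_mod_cast hK0
        rcases hs with rfl | rfl <;> nlinarith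
    · rw [Set.mem_singleton_iff] at hmem
      have e0 := congrArg (fun v : E3 => v 0) hmem
      simp only [PiLp.add_apply, PiLp.smul_apply, hq₁0, smul_eq_mul] at e0
      have hp0 : p₀ 0 = 0 := by simp [p₀, layerNormal]
      rw [hp0] at e0
      norm_num [ha_def] at e0
  by_cases hm : m₀ = m₁
  · -- same coset: `p₀ = A'(z₁ - z₀)` is too short
    subst hm
    have hdiff : p₀ = A' (z₁ - z₀) := by
      rw [map_sub]
      have := congrArg₂ (· - ·) e₁ e₀
      simpa using this
    have hne : z₁ - z₀ ≠ 0 := by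
      intro hz
      rw [hz, map_zero] at hdiff
      have : ‖p₀‖ = 0 := by rw [hdiff, norm_zero]
      rw [hp₀] at this
      norm_num at this
    have h1 := hcpLiouvilleLam_one_le_norm (hcpLiouvilleLam_sub_mem hz₁ hz₀) hne
    have h2 := hlow (z₁ - z₀)
    rw [← hdiff, hp₀] at h2
    linarith
  · -- different cosets: `X` would be invariant under the short translation `±p₀` on one coset
    have hm₂ : m₂ = m₀ ∨ m₂ = m₁ := by
      clear e₀ e₁ e₂ hX notin hlow
      fin_cases m₀ <;> fin_cases m₁ <;> fin_cases m₂ <;> simp at hm ⊢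
    rcases hm₂ with rfl | rfl
    · apply notin 1 (Or.inl rfl)
      rw [one_smul, hX]
      refine ⟨m₁, z₂ + (z₁ - z₀), hcpLiouvilleLam_add_mem hz₂ (hcpLiouvilleLam_sub_mem hz₁ hz₀), ?_⟩
      have e : t' m₁ = p₀ - A' z₁ := eq_sub_of_add_eq e₁.symm
      rw [e, e₂, map_add, map_sub]
      have e' : t' m₂ = -A' z₀ := eq_neg_of_add_eq_zero_left e₀.symm
      rw [e']
      abel
    · apply notin (-1) (Or.inr rfl)
      rw [neg_one_smul, hX]
      refine ⟨m₀, z₂ - (z₁ - z₀), hcpLiouvilleLam_sub_mem hz₂ (hcpLiouvilleLam_sub_mem hz₁ hz₀), ?_⟩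
      have e : t' m₀ = -A' z₀ := eq_neg_of_add_eq_zero_left e₀.symm
      have e' : t' m₂ = p₀ - A' z₁ := eq_sub_of_add_eq e₁.symm
      rw [e, e₂, e', map_sub, map_sub]
      abel

end Summit.AtomisticToContinuum.Crystallization.Theorems
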